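import Literature.AnabelianGeometry.AbsoluteAnabelian.AbsTopIII.Thm19KummerContainerEmbeddingProofs
import HarnessLib

/-!
# [AbsTopIII] Thm. 1.9 (d): the tower of a directed system of NF-complements — the interface laws of
# the (d)-rows as ONE successor structure (cell abc-iut GAP-LEDGER G-w5d213-1 / G-w5d213-2)

Mochizuki, *Topics in Absolute Anabelian Geometry III*, §1, Theorem 1.9 (d), manuscript pp. 37–38
(lit key `paper:url-5493eb38cbb7`): "`k̄_NF^× ⊆ K_{Z_NF}^× ↪ lim_{→V} H¹(Π_V, μ_Ẑ(Π_U))` — where `V` ranges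
over the open subschemes obtained by removing finite collections of NF-points from `Z ×_{k_Z} k′`, for `k′`
a finite extension of `k_Z`; [...] `K_{Z_NF}` is the function field of the curve `Z_NF` obtained by
descending `Z ×_{k_Z} k̄` to `k̄_NF`; the '`↪`' arises from the Kummer map"; Prop. 1.6 p. 34: "the
associated Kummer map [cf. [Mzk19] §2]" (functorial in the curve); Def. 1.7 (ii) p. 35 (NF-rational
functions, NF-constants "that descend to `k̄_NF`").

Sub-DAG `plan/L4/SUBDAG-AbsTopIII-Thm19.md`, rows Thm19.d.r8–r10 (cell abc-iut; abc-iut-L4-lead QUICK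
RULINGS #3w (2)(a) 2026-08-26T03:27:30Z: "a sibling structure/def file, never an edit of [abc-iut-L4-t1's]
frozen interface").  The one-base-field interface `CurveModel` / `IntrinsicKummerModel` (abc-iut-L4-t1)
records the function field, the points, the Kummer map `κ_U` PER CURVE and carries NO morphism /
base-change / descent structure; the directed system `CurveModel.NFComplementSystem` (abc-iut-w5-d213,
p414838) therefore records its transitions and base-change legs as BARE homomorphisms of extensions.  The
discharges of the (d)-rows (abc-iut-w5-d099 `thm19d_inj_of_naturality`; abc-iut-w5-d213
`thm19d_constants_of_laws`, `thm19d_functionField_of_laws`, p419012 / p419376) consume, as explicit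
binders, the laws this interface cannot supply.  THIS FILE packages exactly those binders as ONE
successor structure PER DIRECTED SYSTEM, `IntrinsicKummerModel.NFTower M S Ω` — INTERFACE DATA in the
sense of the cell's typing policy θ (true at the intended étale-`π₁` model; NOT a published prerequisite,
NOT a named Prop fact; to be MERGED into the abc-iut-L4-t1 lineage's morphism-indexed successor of
`IntrinsicKummerModel`, whose field list it is):

* G-w5d213-1 (abc-iut-w5-d099's verbatim shape): restriction of regular units along the transitions
  (`res`, injective) and the NATURALITY square of the Kummer maps with coefficients `M_Z` (`naturality`);
* G-w5d213-2: (a) Def. 1.7 (ii) link "NF-constant ⟺ NF-rational constant function"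
  (`isNFConstant_iff`); (b) constants are regular units (`const_mem`); (c) the tower of base fields
  `k′_i → k̄` (`baseEmb`, compatible with `res`, detecting NF-constants, exhausting `k̄_NF`); (d) the tower
  of function fields `K_{V_i} → Ω ⊇ K_{Z_NF}` (`fnEmb`, `nfEmb`, compatible with `res`, detecting
  NF-rationality, every `f ∈ K_{Z_NF}^×` eventually a regular unit); (e) eventual existence of nonconstant
  NF-rational regular units (`rich`).

Over it, the landed closers become `thm19d_constants_of_tower`, `thm19d_functionField_of_tower`,
`thm19d_of_tower` (proof-only sibling `Thm19KummerTowerProofs.lean`; inputs: abc-iut-L4-t1's named facts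
`Prop_1_8_i`, `Prop_1_8_ii`, `Prop_1_6_iii_units`, `Prop_1_6_iii_ker`, `Rmk_1_5_4_i`, the row `Thm19d_inj`
BY NAME, and ONE tower per directed system).  This file: the structure ONLY (statements-first).
HONEST FRAMING: statements-first interface data; typed ≠ proved; nothing here bears on [IUTchIII] Cor. 3.12.
-/

noncomputable section

open CategoryTheory
open scoped Classical

namespace Literature.AnabelianGeometry.AbsoluteAnabelian.AbsTopIII

universe u

namespace IntrinsicKummerModel

/-- **The tower of a directed system of NF-complements** (Thm. 1.9 (d)): for `M : IntrinsicKummerModel`, a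
system `S` of NF-complements over `Z` and a common field `Ω` (at the intended model `Ω = K_{Z ×_{k_Z} k̄}`),
the INTERFACE DATA relating the levels that the one-base-field interface does not carry — restriction of
regular units along the transitions with the naturality of the Kummer maps ("the associated Kummer map",
Prop. 1.6, functorial in the curve), the towers of base fields `k′_i ⊆ k̄` and of function fields
`K_{V_i} ⊆ Ω ⊇ K_{Z_NF}` with Def. 1.7 (ii)'s descent predicates as image conditions, and the cofinal
existence of nonconstant NF-rational units.  Cell abc-iut GAP-LEDGER G-w5d213-1 / G-w5d213-2 (field list of
the successor interface; to be merged by the abc-iut-L4-t1 lineage).  No instance is declared; `Ω` and its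
field structure are parameters. [cite: MochizukiAbsTopIII2015, Thm 1.9 (d) p.37] -/
structure NFTower (M : IntrinsicKummerModel.{u}) {Z : M.Curve} {ι : Type u} [Preorder ι]
    (S : CurveModel.NFComplementSystem M.toCurveModel Z ι) (Ω : Type u) [Field Ω] : Type u where
  /-- restriction of regular units `Γ(V_i, 𝒪^×) → Γ(V_j, 𝒪^×)` along the transition `V_j → V_i` (`i ≤ j`),
  written additively (G-w5d213-1, data) -/
  res : ∀ ⦃i j : ι⦄, i ≤ j → (Additive (M.regularUnits (S.V i)) →+ Additive (M.regularUnits (S.V j)))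
  /-- restriction of units along a dominant morphism is injective (G-w5d213-1 (a)) -/
  res_injective : ∀ ⦃i j : ι⦄ (h : i ≤ j), Function.Injective (res h)
  /-- NATURALITY of the Kummer maps with coefficients `M_Z`: "`κ` pulled back along the transition = `κ`
  of the restricted unit" (G-w5d213-1 (b); [AbsTopIII] Prop. 1.6 p. 34 "the associated Kummer map") -/
  naturality : ∀ ⦃i j : ι⦄ (h : i ≤ j) (f : Additive (M.regularUnits (S.V i))),
    S.transition i j h (M.kummerLevel S i f) = M.kummerLevel S j (res h f)
  /-- constants are regular units: `ord_x(c) = 0` at every closed point (G-w5d213-2 (b)) -/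
  const_mem : ∀ (i : ι) (c : (M.base (S.V i))ˣ),
    Units.map (algebraMap (M.base (S.V i)) (M.FunctionField (S.V i)) : _ →* _) c ∈ M.regularUnits (S.V i)
  /-- Def. 1.7 (ii): an element of `k′` is an NF-constant iff it is NF-rational as a (constant) function
  (G-w5d213-2 (a)) -/
  isNFConstant_iff : ∀ (i : ι) (c : (M.base (S.V i))ˣ), M.IsNFConstant (S.V i) (c : M.base (S.V i)) ↔
    M.IsNFRational (S.V i) (algebraMap (M.base (S.V i)) (M.FunctionField (S.V i)) c)
  /-- the tower of base fields: `k′_i ⊆ k̄ = k̄_Z` (G-w5d213-2 (c), data) -/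
  baseEmb : ∀ i : ι, M.base (S.V i) →+* AlgebraicClosure (M.base Z)
  /-- restriction maps the constant `c ∈ k′_i` to the SAME constant of `k′_j ⊇ k′_i` -/
  baseEmb_res : ∀ ⦃i j : ι⦄ (h : i ≤ j) (c : (M.base (S.V i))ˣ), ∃ c' : (M.base (S.V j))ˣ,
    baseEmb j (c' : M.base (S.V j)) = baseEmb i (c : M.base (S.V i)) ∧
      res h (Additive.ofMul ⟨_, const_mem i c⟩) = Additive.ofMul ⟨_, const_mem j c'⟩
  /-- Def. 1.7 (ii): "NF-constants [...] that descend to `k̄_NF`" — `c` is an NF-constant iff `c ∈ k̄_NF` -/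
  isNFConstant_iff_mem : ∀ (i : ι) (c : (M.base (S.V i))ˣ),
    M.IsNFConstant (S.V i) (c : M.base (S.V i)) ↔ baseEmb i (c : M.base (S.V i)) ∈ M.kbarNF Z
  /-- "`k′` a[ny] finite extension of `k_Z`": the base fields exhaust `k̄_NF` along the system -/
  baseEmb_exhaust : ∀ (i : ι) (a : AlgebraicClosure (M.base Z)), a ∈ M.kbarNF Z →
    ∃ j : ι, i ≤ j ∧ a ∈ Set.range (baseEmb j)
  /-- the tower of function fields: `K_{V_i} ⊆ Ω` (G-w5d213-2 (d), data) -/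
  fnEmb : ∀ i : ι, M.FunctionField (S.V i) →+* Ω
  /-- "`K_{Z_NF}` is the function field of the curve `Z_NF` obtained by descending `Z ×_{k_Z} k̄` to `k̄_NF`":
  `K_{Z_NF} ⊆ Ω` -/
  nfEmb : M.NFFunctionField Z →+* Ω
  /-- restriction of units is the inclusion of function fields -/
  fnEmb_res : ∀ ⦃i j : ι⦄ (h : i ≤ j) (f : M.regularUnits (S.V i)),
    fnEmb j (((Additive.toMul (res h (Additive.ofMul f)) : M.regularUnits (S.V j)) :
      (M.FunctionField (S.V j))ˣ) : M.FunctionField (S.V j)) =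
      fnEmb i ((f : (M.FunctionField (S.V i))ˣ) : M.FunctionField (S.V i))
  /-- Def. 1.7 (ii): "NF-rational functions [...] that descend to `k̄_NF`" — `g ∈ K_{V_i}` is NF-rational iff
  `g ∈ K_{Z_NF}` inside `Ω` -/
  isNFRational_iff : ∀ (i : ι) (g : M.FunctionField (S.V i)),
    M.IsNFRational (S.V i) g ↔ fnEmb i g ∈ Set.range nfEmb
  /-- every `f ∈ K_{Z_NF}^×` is eventually a regular unit of a level (its zeros and poles are NF-points,
  removed at some level; `f` is defined over some `k′`) -/
  nfEmb_exhaust : ∀ (i : ι) (a : M.NFFunctionField Z), a ≠ 0 → ∃ j : ι, i ≤ j ∧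
    ∃ f : M.regularUnits (S.V j), fnEmb j ((f : (M.FunctionField (S.V j))ˣ) : M.FunctionField (S.V j)) =
      nfEmb a
  /-- cofinally, the levels carry nonconstant NF-rational regular units (the standing hypothesis of Prop.
  1.8 (ii); G-w5d213-2 (e)) -/
  rich : ∀ i : ι, ∃ (j : ι) (_ : i ≤ j) (g : M.regularUnits (S.V j)),
    M.IsNFRational (S.V j) ((g : (M.FunctionField (S.V j))ˣ) : M.FunctionField (S.V j)) ∧
      ¬ M.IsConstantUnit (g : (M.FunctionField (S.V j))ˣ)

end IntrinsicKummerModel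

end Literature.AnabelianGeometry.AbsoluteAnabelian.AbsTopIII
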